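import Literature.AnabelianGeometry.EtaleTheta.TemperedCoverings

/-!
# [EtTh] §3: Definition 3.3 (i)(b), the bracket "[which is necessarily characteristic as a subgroup
# of `Δ`]" — proof

Mochizuki, *The étale theta function …*, Publ. RIMS **45** (2009), §3, Definition 3.3 (i), PRIMS PDF
p. 72 (printed 298) [cite: MochizukiEtTh2009, Def 3.3 p.72]: a tempered filter consists of characteristic
open subgroups of finite index `Δ^fil_i ⊆ Δ` such that "(b) every `Δ^fil_i` admits a minimal co-free
subgroup `Δ^{fil,∞}_i` [which is necessarily characteristic as a subgroup of `Δ`]". The statement file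
`TemperedCoverings.lean` (seat abc-iut-L2-t3) proves the bracket in the weaker form
`TemperedFilter.closure_map_eq` (invariance under topological automorphisms of `Δ^fil_i`). This
proof-only companion DISCHARGES the printed form: `Δ^{fil,∞}_i` is carried onto itself by every
topological automorphism of `Δ` (`TemperedFilter.isTopCharacteristic_closure`) — restrict the
automorphism to the characteristic subgroup `Δ^fil_i` and apply `closure_map_eq`. No definitions.
Seat abc-iut-L6-t12 (unit W2-L2-09).
-/

namespace Literature.AnabelianGeometry.EtaleTheta

universe u

namespace TemperedFilter

variable {Δ : Type u} [Group Δ] [TopologicalSpace Δ] (F : TemperedFilter Δ)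

/-- **Definition 3.3 (i)(b), bracket — discharged** (p. 72): the minimal co-free subgroup
`Δ^{fil,∞}_i` of `Δ^fil_i` "is necessarily characteristic as a subgroup of `Δ`": every isomorphism of
topological groups `Δ ≃ Δ` carries `Δ^{fil,∞}_i` onto itself (it preserves the characteristic subgroup
`Δ^fil_i`, and its restriction to `Δ^fil_i` preserves the minimal co-free subgroup, §0 p. 9 /
`closure_map_eq`). [cite: MochizukiEtTh2009, Def 3.3 p.72] -/
theorem isTopCharacteristic_closure (i : F.I) : IsTopCharacteristic Δ (F.closure i) := by
  intro φ
  have hchar : (F.fil i).map φ.toMulEquiv.toMonoidHom = F.fil i := F.isTopCharacteristic_fil i φ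
  have hmem : ∀ x : Δ, x ∈ F.fil i → φ x ∈ F.fil i := fun x hx => by
    have h := Subgroup.mem_map_of_mem φ.toMulEquiv.toMonoidHom hx
    rw [hchar] at h
    exact h
  have hmem' : ∀ x : Δ, x ∈ F.fil i → φ.symm x ∈ F.fil i := fun x hx => by
    rw [← hchar] at hx
    obtain ⟨y, hy, hyx⟩ := Subgroup.mem_map.mp hx
    have h : φ.symm x = y := by
      rw [← hyx]
      exact φ.symm_apply_apply y
    rw [h]
    exact hy
  let ψ : F.fil i ≃ₜ* F.fil i :=
    { toFun := fun x => ⟨φ x, hmem x x.2⟩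
      invFun := fun x => ⟨φ.symm x, hmem' x x.2⟩
      left_inv := fun x => Subtype.ext (φ.symm_apply_apply (x : Δ))
      right_inv := fun x => Subtype.ext (φ.apply_symm_apply (x : Δ))
      map_mul' := fun x y => Subtype.ext (map_mul φ (x : Δ) (y : Δ))
      continuous_toFun := (φ.continuous.comp continuous_subtype_val).subtype_mk _
      continuous_invFun := (φ.symm.continuous.comp continuous_subtype_val).subtype_mk _ }
  have key := F.closure_map_eq i ψ
  have hcomp : φ.toMulEquiv.toMonoidHom.comp (F.fil i).subtype =
      (F.fil i).subtype.comp ψ.toMulEquiv.toMonoidHom := MonoidHom.ext fun _ => rfl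
  have hinf : F.closure i ⊓ F.fil i = F.closure i := inf_eq_left.mpr (F.closure_le i)
  calc (F.closure i).map φ.toMulEquiv.toMonoidHom
      = (((F.closure i).subgroupOf (F.fil i)).map (F.fil i).subtype).map
          φ.toMulEquiv.toMonoidHom := by rw [Subgroup.subgroupOf_map_subtype, hinf]
    _ = ((F.closure i).subgroupOf (F.fil i)).map
          (φ.toMulEquiv.toMonoidHom.comp (F.fil i).subtype) := Subgroup.map_map _ _ _
    _ = ((F.closure i).subgroupOf (F.fil i)).map
          ((F.fil i).subtype.comp ψ.toMulEquiv.toMonoidHom) := by rw [hcomp]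
    _ = (((F.closure i).subgroupOf (F.fil i)).map ψ.toMulEquiv.toMonoidHom).map
          (F.fil i).subtype := (Subgroup.map_map _ _ _).symm
    _ = ((F.closure i).subgroupOf (F.fil i)).map (F.fil i).subtype := by rw [key]
    _ = F.closure i := by rw [Subgroup.subgroupOf_map_subtype, hinf]

end TemperedFilter

end Literature.AnabelianGeometry.EtaleTheta
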